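import Mathlib.AlgebraicGeometry.Geometrically.Irreducible
import Mathlib.AlgebraicGeometry.PullbackCarrier
import HarnessLib

/-!
# A scheme glued from two geometrically irreducible charts meeting in every fibre is geometrically irreducible

Let `𝒱 → S` be GEOMETRICALLY IRREDUCIBLE and let `i₁, i₂ : 𝒱 → 𝒲` be two `S`-morphisms which are open
immersions, jointly surjective, whose images meet inside every non-empty fibre of `𝒲 → S`.  Then
`𝒲 → S` is geometrically irreducible (`geometricallyIrreducible_of_isOpenImmersion_pair`): over a field
point `Spec K → S` the base change `𝒲_K` is covered by the two open immersions `𝒱_K ↪ 𝒲_K` (base changes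
of `i₁, i₂`), each with irreducible source, and their images meet (a point of `i₁(𝒱) ∩ i₂(𝒱)` over the
image of `Spec K` lifts to `𝒲_K`); a space covered by two irreducible opens with non-empty intersection
is irreducible (`isPreirreducible_of_union_of_isOpen`).

This is the fibrewise-irreducibility bookkeeping of [Artin1986NeronModels] Lemma 2.4 («replace `V′` by
`V′ ∪ V′_s`, glued along the translate chart; `V` is dense in each fibre of `V′`»), in Mathlib's
`GeometricallyIrreducible` currency, which the road-W stage invariant carries.

Theorems only; Mathlib-only imports.  Generic leaf for cell `hodgecm-mathlib` (D-0151), road W, A-p06's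
(G2a″) carve-out; independent of the road.

## References
* [Artin1986NeronModels] M. Artin, *Néron models*, in Cornell–Silverman (1986), §2, Lemma 2.4 (p. 222).
* [GortzWedhorn2020] U. Görtz, T. Wedhorn, *Algebraic Geometry I* (2nd ed., 2020), §(3.5) (gluing),
  §(4.11)/(4.13) (fibres and base change), Exercise 2.9 (irreducibility is checked on an open cover with
  pairwise meeting members).
-/

universe u

open CategoryTheory CategoryTheory.Limits Topology TopologicalSpace

namespace Literature.AlgebraicGeometry.Morphisms

open _root_.AlgebraicGeometry

/-! ### Topology: two irreducible opens with non-empty intersection -/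

/-- A topological space covered by two preirreducible OPEN subsets with non-empty intersection is
preirreducible. [cite: GortzWedhorn2020, Exercise 2.9] -/
theorem isPreirreducible_univ_of_union_of_isOpen {X : Type*} [TopologicalSpace X] {X₁ X₂ : Set X}
    (hO₁ : IsOpen X₁) (hcover : X₁ ∪ X₂ = Set.univ) (hX₁ : IsPreirreducible X₁)
    (hX₂ : IsPreirreducible X₂) (hne : (X₁ ∩ X₂).Nonempty) : IsPreirreducible (Set.univ : Set X) := by
  -- every non-empty open meets `X₁`
  have key : ∀ W : Set X, IsOpen W → W.Nonempty → (X₁ ∩ W).Nonempty := by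
    rintro W hW ⟨z, hzW⟩
    have hz : z ∈ X₁ ∪ X₂ := by rw [hcover]; trivial
    rcases hz with hz | hz
    · exact ⟨z, hz, hzW⟩
    · obtain ⟨y, hy₁, hy₂⟩ := hne
      obtain ⟨x, hxX₂, hxW, hxO₁⟩ := hX₂ W X₁ hW hO₁ ⟨z, hz, hzW⟩ ⟨y, hy₂, hy₁⟩
      exact ⟨x, hxO₁, hxW⟩
  intro U V hU hV hZU hZV
  obtain ⟨x, hx, hxUV⟩ := hX₁ U V hU hV (key U hU (by simpa using hZU)) (key V hV (by simpa using hZV))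
  exact ⟨x, Set.mem_univ x, hxUV⟩

/-- The range of a continuous map from an irreducible space is preirreducible (plumbing over Mathlib
`IsPreirreducible.image`). [folklore] -/
private theorem isPreirreducible_range_of_irreducibleSpace {X Y : Type*} [TopologicalSpace X] [TopologicalSpace Y]
    [IrreducibleSpace X] {f : X → Y} (hf : Continuous f) : IsPreirreducible (Set.range f) := by
  rw [← Set.image_univ]
  exact (PreirreducibleSpace.isPreirreducible_univ (X := X)).image f hf.continuousOn

/-! ### The criterion -/

/-- **Base change of a chart.**  For an `S`-morphism `i : 𝒱 → 𝒲`, a field point `y : Spec K → S` and a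
cartesian square `Z = 𝒲 ×_S Spec K`, the induced map `j : 𝒱 ×_S Spec K → Z` sits in a cartesian square over
`i`; in particular it is an open immersion when `i` is. [cite: GortzWedhorn2020, §(4.11) (base change)] -/
theorem isPullback_lift_of_over {S : Scheme.{u}} {𝒱 𝒲 : Over S} (i : 𝒱 ⟶ 𝒲) {T Z : Scheme.{u}}
    (y : T ⟶ S) {fst : Z ⟶ 𝒲.left} {snd : Z ⟶ T} (hZ : IsPullback fst snd 𝒲.hom y) :
    IsPullback
      (hZ.lift (pullback.fst 𝒱.hom y ≫ i.left) (pullback.snd 𝒱.hom y)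
        (by rw [Category.assoc, Over.w i]; exact pullback.condition))
      (pullback.fst 𝒱.hom y) fst i.left := by
  refine IsPullback.of_right (h₁₂ := snd) (v₁₃ := y) (h₂₂ := 𝒲.hom) ?_ (hZ.lift_fst _ _ _) hZ.flip
  rw [hZ.lift_snd, Over.w i]
  exact (IsPullback.of_hasPullback 𝒱.hom y).flip

/-- **A scheme glued from two geometrically irreducible charts whose images meet in every fibre is
geometrically irreducible** ([Artin1986NeronModels] Lemma 2.4, the fibres of `V′ ∪ V′_s`).  Hypotheses:
`i₁, i₂ : 𝒱 → 𝒲` over `S`, open immersions, jointly surjective; `𝒱 → S` geometrically irreducible; for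
every `t ∈ S` with non-empty fibre `𝒲_t`, the images of `i₁` and `i₂` meet inside `𝒲_t`.
[cite: Artin1986NeronModels, §2 Lemma 2.4 (p. 222)] [cite: GortzWedhorn2020, Exercise 2.9 and §(4.11)] -/
theorem geometricallyIrreducible_of_isOpenImmersion_pair {S : Scheme.{u}} {𝒱 𝒲 : Over S}
    (i₁ i₂ : 𝒱 ⟶ 𝒲) [IsOpenImmersion i₁.left] [IsOpenImmersion i₂.left]
    [GeometricallyIrreducible 𝒱.hom]
    (hcover : Set.range i₁.left.base ∪ Set.range i₂.left.base = Set.univ)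
    (hmeet : ∀ t : S, (𝒲.hom.base ⁻¹' {t}).Nonempty →
      (Set.range i₁.left.base ∩ Set.range i₂.left.base ∩ 𝒲.hom.base ⁻¹' {t}).Nonempty) :
    GeometricallyIrreducible 𝒲.hom := by
  refine ⟨fun K _ y Z fst snd hZ => ?_⟩
  -- the chart `𝒱_K`, irreducible
  haveI hVK : IrreducibleSpace ↑(pullback 𝒱.hom y) :=
    GeometricallyIrreducible.geometrically_irreducibleSpace _ _ _ (.of_hasPullback 𝒱.hom y)
  -- the two base-changed charts `j₁, j₂ : 𝒱_K → Z`
  let j₁ : pullback 𝒱.hom y ⟶ Z := hZ.lift (pullback.fst 𝒱.hom y ≫ i₁.left) (pullback.snd 𝒱.hom y)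
    (by rw [Category.assoc, Over.w i₁]; exact pullback.condition)
  let j₂ : pullback 𝒱.hom y ⟶ Z := hZ.lift (pullback.fst 𝒱.hom y ≫ i₂.left) (pullback.snd 𝒱.hom y)
    (by rw [Category.assoc, Over.w i₂]; exact pullback.condition)
  have hsq₁ := isPullback_lift_of_over i₁ y hZ
  have hsq₂ := isPullback_lift_of_over i₂ y hZ
  haveI : IsOpenImmersion j₁ := MorphismProperty.of_isPullback (P := @IsOpenImmersion) hsq₁.flip inferInstance
  haveI : IsOpenImmersion j₂ := MorphismProperty.of_isPullback (P := @IsOpenImmersion) hsq₂.flip inferInstance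
  have hj₁f : j₁ ≫ fst = pullback.fst 𝒱.hom y ≫ i₁.left := hZ.lift_fst _ _ _
  have hj₂f : j₂ ≫ fst = pullback.fst 𝒱.hom y ≫ i₂.left := hZ.lift_fst _ _ _
  -- ranges: points of `Z` over `iₖ(𝒱)` lift to `𝒱_K`
  have hlift₁ : ∀ z : Z, fst z ∈ Set.range i₁.left.base → z ∈ Set.range j₁ := by
    rintro z ⟨v, hv⟩
    obtain ⟨p, hp₁, hp₂⟩ := Scheme.exists_preimage_of_isPullback hsq₁.flip v z (by exact hv)
    exact ⟨p, hp₂⟩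
  have hlift₂ : ∀ z : Z, fst z ∈ Set.range i₂.left.base → z ∈ Set.range j₂ := by
    rintro z ⟨v, hv⟩
    obtain ⟨p, hp₁, hp₂⟩ := Scheme.exists_preimage_of_isPullback hsq₂.flip v z (by exact hv)
    exact ⟨p, hp₂⟩
  -- cover
  have hcov : Set.range j₁ ∪ Set.range j₂ = Set.univ := by
    refine Set.eq_univ_of_forall fun z => ?_
    have hz : fst z ∈ Set.range i₁.left.base ∪ Set.range i₂.left.base := by rw [hcover]; trivial
    rcases hz with hz | hz
    · exact Or.inl (hlift₁ z hz)
    · exact Or.inr (hlift₂ z hz)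
  -- a point of `Z` (the chart is non-empty) and the base point `t`
  obtain ⟨v₀⟩ := (inferInstance : Nonempty ↑(pullback 𝒱.hom y))
  let z₀ : Z := j₁ v₀
  let t : S := 𝒲.hom (fst z₀)
  have ht : (𝒲.hom.base ⁻¹' {t}).Nonempty := ⟨fst z₀, rfl⟩
  obtain ⟨w, ⟨hw₁, hw₂⟩, hwt⟩ := hmeet t ht
  -- `w` lifts to `Z`: `𝒲.hom w = t = y (snd z₀)`
  have hwy : 𝒲.hom.base w = y.base (snd z₀) := by
    rw [show 𝒲.hom.base w = t from hwt]
    change (fst ≫ 𝒲.hom) z₀ = (snd ≫ y) z₀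
    rw [hZ.w]
  obtain ⟨z, hz₁, -⟩ := Scheme.exists_preimage_of_isPullback hZ w (snd z₀) hwy
  have hne : (Set.range j₁ ∩ Set.range j₂).Nonempty :=
    ⟨z, hlift₁ z (hz₁ ▸ hw₁), hlift₂ z (hz₁ ▸ hw₂)⟩
  -- conclude
  have hirr : IsPreirreducible (Set.univ : Set Z) :=
    isPreirreducible_univ_of_union_of_isOpen j₁.isOpenEmbedding.isOpen_range hcov
      (isPreirreducible_range_of_irreducibleSpace j₁.continuous)
      (isPreirreducible_range_of_irreducibleSpace j₂.continuous) hne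
  haveI : PreirreducibleSpace Z := ⟨hirr⟩
  haveI : Nonempty Z := ⟨z₀⟩
  exact ⟨inferInstance⟩

end Literature.AlgebraicGeometry.Morphisms
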